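/-
Width seat `ym-line-sgb-p1-w3` (seat prover-ym-line-sgb-p1-w3-g0-0), route `SteinGapBootstrap`, ASSEMBLY item (stmt-QuantumFields-22997):
helper lemmas for `Assembly_proof` (file `SteinGapBootstrapAssembly.lean`).
-/
import Summits.QuantumFields.YangMills.Theorems.WeakCouplingRates
import Summits.QuantumFields.YangMills.Theorems.WeakCouplingRatesCurvatureCorrPowerFloor
import Summits.QuantumFields.YangMills.Theorems.EquipartitionCriticalityEquipartitionPinsProbeReduction
import HarnessLib

/-!
# Route `SteinGapBootstrap`, Assembly (stmt-QuantumFields-22997) — preparatory lemmas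

NOT THE CLAY GAP (glue for a line on the RECORD-label rung leaf `WeakCouplingRates.XiPow`, an UPPER bound on the lattice gap).

The Assembly `SteinBlockTransferG → GapGivesClusteringG → PolySmallFieldsG → AxisSymmetryG → XiPow` is the xiDiv-pattern contradiction of
`massGapVanishesOf_allSimpleG` made quantitative.  This file isolates the β-independent pieces:

* §1 the equipartition PROBE `P_β(U) = exp(−2 (β (N − Re tr r(U_p)))₊)` at the origin `(1,2)`-plaquette: a bounded (`0 < P ≤ 1`)
  continuous cylinder observable on time-zero spatial links, hence `θ`-invariant; its shift `P ∘ α_s` is a positive-time observable and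
  `rpCorr μ (P∘α_s) k = probeCov μ (k + 2s)` for every torus-limit state (B-TI) — `rpCorr_probe_shift`;
* §2 the free-gluon PROFILE floor: with the tree's `CurvatureCorrPowerFloor` (`κ n⁻⁴ ≤ |c_n|`), `corr_pos`, `corr_le` and the Bernoulli
  bound `rpow_neg_sub_one_ge`, `2^{−D}((1 − c_n²)^{−D/2} − 1) ≥ (2^{−D}(D/2)κ²) / n⁸` for `n ≥ n₀`, and `≥ 0` for all `n ≥ 1`;
* §3 two elementary asymptotic facts in `β`.

References: the route thesis (Assembly paragraph); S. Chatterjee, arXiv:1803.01950, Problem 5.1 [ChatterjeeYMProb2019].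
-/

set_option autoImplicit false

noncomputable section

open MeasureTheory Filter Topology
open Literature.MathematicalPhysics
open Literature.MathematicalPhysics.QuantumLattice
open Literature.MathematicalPhysics.QuantumFieldTheory
open Summit.QuantumFields.YangMills.Theorems.WeakCouplingRates

namespace Summit.QuantumFields.YangMills.Theorems.SteinGapBootstrap

/-! ### §1. The probe and its two-time correlator -/

section Probe

variable {G : Type} [Group G] [TopologicalSpace G] [IsTopologicalGroup G] [CompactSpace G]
  [MeasurableSpace G] [BorelSpace G] {N : ℕ} (ρ : G →* Matrix (Fin N) (Fin N) ℂ)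

omit [MeasurableSpace G] [BorelSpace G] in
/-- The probe `U ↦ exp(−2 (β(N − Re tr ρ(U_{(0;1,2)})))₊)` is a continuous cylinder observable on the time-zero spatial links of the origin
`(1,2)`-plaquette, with values in `(0, 1]`. -/
theorem probe_facts (hρ : Continuous ρ) (β : ℝ) :
    ∃ S₀ : Finset (QuantumLattice.ZdEdge 4),
      IsCylinder (fun U : LGConfig 4 G => Real.exp (-2 * max (β * ((N : ℝ) - plaquetteObs ρ 0 1 2 U)) 0)) S₀ ∧
      (∀ e ∈ S₀, e.1 0 = 0 ∧ e.2 ≠ 0) ∧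
      Continuous (fun U : LGConfig 4 G => Real.exp (-2 * max (β * ((N : ℝ) - plaquetteObs ρ 0 1 2 U)) 0)) ∧
      (∀ U : LGConfig 4 G, |Real.exp (-2 * max (β * ((N : ℝ) - plaquetteObs ρ 0 1 2 U)) 0)| ≤ 1) := by
  have h1 : (1 : Fin 4) ≠ 0 := by decide
  have h2 : (2 : Fin 4) ≠ 0 := by decide
  obtain ⟨hcyl, hS⟩ := plaqCost0_support (G := G) ρ h1 h2
  obtain ⟨hcont, -⟩ := continuous_bounded_plaqCost0 (G := G) ρ hρ (1 : Fin 4) 2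
  refine ⟨_, fun U V h => ?_, hS, ?_, fun U => ?_⟩
  · show Real.exp (-2 * max (β * plaqCost0 ρ 1 2 U) 0) = Real.exp (-2 * max (β * plaqCost0 ρ 1 2 V) 0)
    rw [hcyl h]
  · exact Real.continuous_exp.comp (continuous_const.mul ((continuous_const.mul hcont).max continuous_const))
  · rw [abs_of_pos (Real.exp_pos _), Real.exp_le_one_iff]
    nlinarith [le_max_right (β * ((N : ℝ) - plaquetteObs ρ 0 1 2 U)) 0]

variable {β : ℝ} {μ : Measure (LGConfig 4 G)}

/-- **The probe's RP correlator is its two-time covariance.** For a torus-limit state `μ`, a bounded continuous cylinder observable `P`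
supported on time-zero spatial links (so `P ∘ θ = P`) and `s : ℕ`, the positive-time observable `F = P ∘ α_s` has
`rpCorr μ F k = ⟨P · P∘α_{k+2s}⟩_μ − ⟨P⟩_μ ⟨P∘α_{k+2s}⟩_μ` (translation invariance of torus-limit states, B-TI).  (The computation
inside `massGapVanishesOf_allSimpleG`, isolated.) -/
theorem rpCorr_probe_shift (hμ : μ ∈ infiniteVolumeLimitPoints (d := 4) ρ β) {P : LGConfig 4 G → ℝ}
    {S₀ : Finset (QuantumLattice.ZdEdge 4)} (hPcyl : IsCylinder P S₀) (hS : ∀ e ∈ S₀, e.1 0 = 0 ∧ e.2 ≠ 0)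
    (hPc : Continuous P) {C : ℝ} (hPb : ∀ U, |P U| ≤ C) (s k : ℕ) :
    rpCorr μ (fun U => P (timeShiftLG (G := G) s U)) k =
      (∫ U, P U * P (timeShiftLG (G := G) (k + s + s) U) ∂μ) -
        (∫ U, P U ∂μ) * (∫ U, P (timeShiftLG (G := G) (k + s + s) U) ∂μ) := by
  have hPθ : ∀ U, P (timeReflectLG U) = P U := comp_timeReflectLG_eq hPcyl hS
  have hC0 : 0 ≤ C := (abs_nonneg _).trans (hPb 1)
  have hmean : ∀ n : ℕ, ∫ U, P (timeShiftLG (G := G) n U) ∂μ = ∫ U, P U ∂μ := fun n =>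
    integral_comp_configShift_of_mem_limitPoints ρ hμ _ hPcyl hPc ⟨C, hPb⟩
  have hmeanS : ∫ U, P (configShift (Pi.single 0 (s : ℤ)) U) ∂μ = ∫ U, P U ∂μ :=
    integral_comp_configShift_of_mem_limitPoints ρ hμ _ hPcyl hPc ⟨C, hPb⟩
  have hFθ : ∀ U, P (timeShiftLG (G := G) s (timeReflectLG U)) = P (configShift (Pi.single 0 (s : ℤ)) U) :=
    fun U => by rw [timeShiftLG_timeReflectLG, hPθ]
  have hFk : ∀ U, P (timeShiftLG (G := G) s (timeShiftLG (G := G) k U)) = P (timeShiftLG (G := G) (k + s) U) :=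
    fun U => by rw [timeShiftLG_timeShiftLG]
  obtain ⟨J, hJ⟩ : ∃ J : LGConfig 4 G → ℝ, ∀ W, J W = P W * P (timeShiftLG (G := G) (k + s + s) W) :=
    ⟨_, fun _ => rfl⟩
  have hJfun : J = fun W => P W * P (timeShiftLG (G := G) (k + s + s) W) := funext hJ
  have hIJ : ∀ U, P (configShift (Pi.single 0 (s : ℤ)) U) * P (timeShiftLG (G := G) (k + s) U) =
      J (configShift (Pi.single 0 (s : ℤ)) U) := fun U => by
    rw [hJ, timeShiftLG_add_configShift_single]
  have hJcyl : IsCylinder J _ := hJfun ▸ IsCylinder.mul hPcyl (isCylinder_timeShift hPcyl (k + s + s))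
  have hJc : Continuous J := hJfun ▸ hPc.mul (hPc.comp (continuous_timeShiftLG (k + s + s)))
  have hJb : ∃ C', ∀ W, |J W| ≤ C' := ⟨C * C, fun W => by
    rw [hJ, abs_mul]
    exact mul_le_mul (hPb _) (hPb _) (abs_nonneg _) hC0⟩
  have hJint : ∫ U, J (configShift (Pi.single 0 (s : ℤ)) U) ∂μ = ∫ U, J U ∂μ :=
    integral_comp_configShift_of_mem_limitPoints ρ hμ _ hJcyl hJc hJb
  rw [hmean]
  simp only [rpCorr, hFθ, hFk, hIJ, hmeanS, hmean]
  rw [hJint]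
  simp_rw [hJ]

omit [Group G] [IsTopologicalGroup G] [CompactSpace G] [BorelSpace G] in
/-- The shifted probe `P ∘ α_s` is a positive-time observable (for `P` a bounded continuous cylinder observable on time-zero links). -/
theorem isPosTimeObs_probe_shift {P : LGConfig 4 G → ℝ} {S₀ : Finset (QuantumLattice.ZdEdge 4)}
    (hPcyl : IsCylinder P S₀) (hS : ∀ e ∈ S₀, e.1 0 = 0 ∧ e.2 ≠ 0) (hPc : Continuous P) {C : ℝ} (hPb : ∀ U, |P U| ≤ C)
    (s : ℕ) : IsPosTimeObs (fun U => P (timeShiftLG (G := G) s U)) := by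
  refine ⟨⟨_, isCylinder_timeShift hPcyl s, fun e he => ?_⟩, hPc.comp (continuous_timeShiftLG s), C, fun U => hPb _⟩
  obtain ⟨e', he', rfl⟩ := Finset.mem_image.1 he
  have := (hS e' he').1
  simp [this]

end Probe

/-! ### §2. The free-gluon profile floor -/

section Profile

open Summit.QuantumFields.YangMills.Theorems.EquipartitionPinsProbe.Reduction

/-- Bernoulli floor of the profile: `2^{−D} (D/2) c² ≤ 2^{−D} ((1 − c²)^{−D/2} − 1)` for `0 ≤ D`, `0 < c ≤ 2/3`. -/
theorem profile_ge_sq {D c : ℝ} (hD : 0 ≤ D) (hc1 : c ≤ 2 / 3) (hc0 : 0 < c) :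
    (2 : ℝ) ^ (-D) * (D / 2) * c ^ 2 ≤ (2 : ℝ) ^ (-D) * ((1 - c ^ 2) ^ (-(D / 2)) - 1) := by
  have hc2 : c ^ 2 < 1 := by nlinarith
  have h := rpow_neg_sub_one_ge (x := c ^ 2) (a := D / 2) hc2 (by linarith)
  have h2 : 0 < (2 : ℝ) ^ (-D) := Real.rpow_pos_of_pos two_pos _
  rw [mul_assoc]
  exact mul_le_mul_of_nonneg_left h h2.le

/-- The profile is non-negative at every `n ≥ 1`: `0 ≤ 2^{−D}((1 − c_n²)^{−D/2} − 1)` (`0 < c_n ≤ 2/3`, `D ≥ 0`). -/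
theorem profile_nonneg {D : ℝ} (hD : 0 ≤ D) {n : ℕ} (hn : 1 ≤ n) :
    0 ≤ (2 : ℝ) ^ (-D) *
      ((1 - (curvaturePlaquetteCorr (d := 4) (by norm_num) (n : ℤ)) ^ 2) ^ (-(D / 2)) - 1) := by
  have hn0 : (n : ℤ) ≠ 0 := by exact_mod_cast (by omega : n ≠ 0)
  have hpos := corr_pos hn0
  have hle := corr_le hn0
  refine le_trans ?_ (profile_ge_sq hD hle hpos)
  have h2 : 0 < (2 : ℝ) ^ (-D) := Real.rpow_pos_of_pos two_pos _
  positivity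

/-- **Profile floor at polynomial separation.** From the tree's `CurvatureCorrPowerFloor` (`κ n⁻⁴ ≤ |c_n|` for `n ≥ n₀`):
`(2^{−D}(D/2)κ²) / n⁸ ≤ 2^{−D}((1 − c_n²)^{−D/2} − 1)` for `n ≥ max n₀ 1`. -/
theorem profile_floor {D : ℝ} (hD : 0 ≤ D) :
    ∃ κ : ℝ, 0 < κ ∧ ∃ n₀ : ℕ, 1 ≤ n₀ ∧ ∀ n : ℕ, n₀ ≤ n →
      (2 : ℝ) ^ (-D) * (D / 2) * κ ^ 2 / (n : ℝ) ^ 8 ≤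
        (2 : ℝ) ^ (-D) * ((1 - (curvaturePlaquetteCorr (d := 4) (by norm_num) (n : ℤ)) ^ 2) ^ (-(D / 2)) - 1) := by
  obtain ⟨κ, hκ, n₀, hfloor⟩ := curvatureCorrPowerFloor_proof
  refine ⟨κ, hκ, max n₀ 1, le_max_right _ _, fun n hn => ?_⟩
  have hn1 : 1 ≤ n := (le_max_right _ _).trans hn
  have hn0 : (n : ℤ) ≠ 0 := by exact_mod_cast (by omega : n ≠ 0)
  have hnpos : (0 : ℝ) < n := by exact_mod_cast (by omega : 0 < n)
  have hpos := corr_pos hn0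
  have hle := corr_le hn0
  have hfl := hfloor n ((le_max_left _ _).trans hn)
  rw [abs_of_pos hpos] at hfl
  -- `κ² / n⁸ ≤ c_n²`
  have hsq : κ ^ 2 / (n : ℝ) ^ 8 ≤ (curvaturePlaquetteCorr (d := 4) (by norm_num) (n : ℤ)) ^ 2 := by
    have hk : 0 ≤ κ / (n : ℝ) ^ 4 := by positivity
    have h := mul_self_le_mul_self hk hfl
    have : κ ^ 2 / (n : ℝ) ^ 8 = κ / (n : ℝ) ^ 4 * (κ / (n : ℝ) ^ 4) := by
      rw [div_mul_div_comm, ← pow_add]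
      norm_num [sq]
    rw [this, sq]
    exact h
  refine le_trans ?_ (profile_ge_sq hD hle hpos)
  have h2 : 0 ≤ (2 : ℝ) ^ (-D) * (D / 2) := mul_nonneg (Real.rpow_pos_of_pos two_pos _).le (by linarith)
  calc (2 : ℝ) ^ (-D) * (D / 2) * κ ^ 2 / (n : ℝ) ^ 8 = (2 : ℝ) ^ (-D) * (D / 2) * (κ ^ 2 / (n : ℝ) ^ 8) := by ring
    _ ≤ (2 : ℝ) ^ (-D) * (D / 2) * (curvaturePlaquetteCorr (d := 4) (by norm_num) (n : ℤ)) ^ 2 :=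
        mul_le_mul_of_nonneg_left hsq h2

end Profile

/-! ### §3. Elementary asymptotics in `β` -/

section Asymptotics

/-- `L₀ + a log β ≤ β^ε / 2` eventually (`ε > 0`). -/
theorem eventually_log_le_rpow_half (L₀ a : ℝ) {ε : ℝ} (hε : 0 < ε) :
    ∀ᶠ β : ℝ in atTop, L₀ + a * Real.log β ≤ β ^ ε / 2 := by
  have hnum : Tendsto (fun β : ℝ => (L₀ + a * Real.log β) / β ^ ε) atTop (𝓝 0) := by
    have h1 : Tendsto (fun β : ℝ => L₀ / β ^ ε) atTop (𝓝 0) :=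
      tendsto_const_nhds.div_atTop (tendsto_rpow_atTop hε)
    have h2 : Tendsto (fun β : ℝ => a * (Real.log β / β ^ ε)) atTop (𝓝 (a * 0)) :=
      ((isLittleO_log_rpow_atTop hε).tendsto_div_nhds_zero).const_mul a
    rw [mul_zero] at h2
    have h3 := h1.add h2
    rw [add_zero] at h3
    refine h3.congr (fun β => ?_)
    ring
  have h12 : (0 : ℝ) < 1 / 2 := by norm_num
  filter_upwards [hnum.eventually (eventually_le_nhds h12), eventually_gt_atTop 0] with β hβ hβ0
  have hβε : 0 < β ^ ε := Real.rpow_pos_of_pos hβ0 ε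
  have := (div_le_iff₀ hβε).1 hβ
  linarith

/-- `c · β^{−a} ≤ b` eventually (`a > 0`, `b > 0`). -/
theorem eventually_mul_rpow_neg_le {a : ℝ} (ha : 0 < a) (c : ℝ) {b : ℝ} (hb : 0 < b) :
    ∀ᶠ β : ℝ in atTop, c * β ^ (-a) ≤ b := by
  have h : Tendsto (fun β : ℝ => c * β ^ (-a)) atTop (𝓝 (c * 0)) := (tendsto_rpow_neg_atTop ha).const_mul c
  rw [mul_zero] at h
  exact h.eventually (eventually_le_nhds hb)

/-- Pure-real error bookkeeping: with `δ = ε (2 K₊ + 20)`, `K₊ = max K 0`, a base `1 ≤ b ≤ 6 β^{2ε}` and `β ≥ 1`,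
`C b^K β^{−δ} ≤ (C 6^{K₊} β^{−4ε}) β^{−16ε}`. -/
theorem err_le {C K ε β b : ℝ} (hC : 0 ≤ C) (hβ : 1 ≤ β) (hb1 : 1 ≤ b) (hb : b ≤ 6 * β ^ (2 * ε)) :
    C * b ^ K * β ^ (-(ε * (2 * max K 0 + 20))) ≤
      C * (6 : ℝ) ^ (max K 0) * β ^ (-(4 * ε)) * β ^ (-(16 * ε)) := by
  have hβ0 : 0 < β := one_pos.trans_le hβ
  have hK : K ≤ max K 0 := le_max_left _ _
  have hK0 : 0 ≤ max K 0 := le_max_right _ _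
  have h1 : b ^ K ≤ b ^ (max K 0) := Real.rpow_le_rpow_of_exponent_le hb1 hK
  have h2 : b ^ (max K 0) ≤ (6 * β ^ (2 * ε)) ^ (max K 0) :=
    Real.rpow_le_rpow (by linarith) hb hK0
  have h3 : (6 * β ^ (2 * ε)) ^ (max K 0) = (6 : ℝ) ^ (max K 0) * β ^ (2 * ε * max K 0) := by
    rw [Real.mul_rpow (by norm_num) (Real.rpow_nonneg hβ0.le _), ← Real.rpow_mul hβ0.le]
  have h4 : β ^ (2 * ε * max K 0) * β ^ (-(ε * (2 * max K 0 + 20))) = β ^ (-(4 * ε)) * β ^ (-(16 * ε)) := by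
    rw [← Real.rpow_add hβ0, ← Real.rpow_add hβ0]
    congr 1
    ring
  have hβδ : 0 ≤ β ^ (-(ε * (2 * max K 0 + 20))) := Real.rpow_nonneg hβ0.le _
  calc C * b ^ K * β ^ (-(ε * (2 * max K 0 + 20)))
      ≤ C * ((6 : ℝ) ^ (max K 0) * β ^ (2 * ε * max K 0)) * β ^ (-(ε * (2 * max K 0 + 20))) := by
        rw [← h3]
        exact mul_le_mul_of_nonneg_right (mul_le_mul_of_nonneg_left (h1.trans h2) hC) hβδ
    _ = C * (6 : ℝ) ^ (max K 0) * (β ^ (2 * ε * max K 0) * β ^ (-(ε * (2 * max K 0 + 20)))) := by ring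
    _ = C * (6 : ℝ) ^ (max K 0) * β ^ (-(4 * ε)) * β ^ (-(16 * ε)) := by rw [h4]; ring

end Asymptotics

end Summit.QuantumFields.YangMills.Theorems.SteinGapBootstrap

end
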